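import Mathlib
import HarnessLib
import Summits.Langlands.Langlands.Theses.EvenArtinQuantumBoundary
import Literature.NumberTheory.GaloisRepresentations.FramedRepDualIrreducible
import Literature.NumberTheory.GaloisRepresentations.FramedRepDualProofs

/-!
# Birth skeleton (BC3) for crux stmt-Langlands-3313
`Summit.Langlands.Langlands.Theses.EvenArtinQuantumBoundary.GaloisBoundaryBounded` (BB) — line `birth`

Route `route-Langlands-EvenArtinQuantumBoundary` (deciding theorem
`closes : QuantumRigidity → GaloisBoundaryBounded → OffEvenArtin → Langlands`). BB says: for every
irreducible EVEN `σ : Γ_ℚ → GL₂(ℂ)` with Dirichlet coefficient sequences `a` (of `L(s,σ)`) and `b` (of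
`L(s,σ^∨)`), (i) the additive twists `Σ a_n e(nx) n^{-s}`, `Σ b_n e(n x') n^{-s}` continue meromorphically
to `ℂ` and are analytic at `s = 0` (regularised values `D_a(0;x)`, `D_b(0;x')`), and (ii) for SOME
admissible constant `c`, `‖c‖ = N^{-1/2}` (`N` the Artin conductor), the formal boundary function
`B(x) = D_a(0;x) − c x⁻¹ D_b(0;−1/(Nx))` of the weight-one Lewis–Fricke transform
`ψ_N(z) = f(z) − c z⁻¹ g(−1/(Nz))` is bounded on every `ℚ ∩ [1/(m+2), m+2]`.

This file concludes BB BY NAME from two named stubs, along the cut the route header itself foresaw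
("(i) KNOWN: Booker 2003 Lemma 1 … (ii) OPEN") sharpened to the Lewis–Zagier prediction:

* `stub_regularisedValue` (KNOWN IN PRINT — Booker 2003, Lemma 1, p. 1092, at `s = 0`; in the tree as the
  undischarged named fact `Literature.NumberTheory.Automorphic.booker_additiveTwist_meromorphic`, whose
  shape lemma `exists_regularisedValue_of_booker_additiveTwist_meromorphic` yields this stub verbatim
  given the fact): for `σ` irreducible even, `a` its coefficient sequence and EVERY rational `α`, the
  additive twist `Σ a_n e(nα) n^{-s}` agrees on `Re s > 1` with a function meromorphic on `ℂ` and analytic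
  at `0`. One coefficient sequence, one rational: the composition applies it to `σ` (for `a`) and to the
  contragredient `σ^∨ = FramedRep.dual σ` (for `b`), which is again irreducible
  (`FramedRep.isIrreducible_toContinuousRep_dual`) and even (`det σ^∨(c) = (det σ(c))⁻¹ = 1`,
  `det_glTransposeInv`) — proved inside the composition, not assumed.
* `stub_quantumContinuity` (OPEN — the bet of the crux in its natural, Lewis–Zagier form): given `σ`, `a`,
  `b` as in BB and ANY pair of regularised-value functions `u, v : ℚ → ℂ` for `a` and `b` (the witnessing
  property of (i) at every rational), some admissible `c` makes `x ↦ u(x) − c x⁻¹ v(−1/(Nx))` the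
  restriction to `ℚ_{>0}` of a function CONTINUOUS on `(0, ∞)`. This is what automorphy delivers
  (route support item `BoundaryNecessity`: `ψ_N` is holomorphic on `ℂ ∖ (−∞,0]`, Lewis–Zagier 2001 Ch. II /
  Bruggeman–Lewis–Zagier 2015, and its value at a rational `x > 0` is the regularised boundary value,
  Bruggeman 2006) and strictly more than BB asks (continuity, not mere boundedness, on each compact) —
  the honest open content, with the uniqueness of regularised values (identity theorem) making the
  "ANY pair `u, v`" quantifier harmless.

Composition `GaloisBoundaryBounded_of (h₁ : _Goal.stub_regularisedValue) (h₂ : _Goal.stub_quantumContinuity) :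
GaloisBoundaryBounded` (kernel-checked, no `sorry`): choose the regularised-value functions `u := D_a(·)(0)`,
`v := D_b(·)(0)` from stub 1 (for `σ` and for `σ^∨`, irreducibility and evenness of the dual proved on the
spot), take `(c, Φ)` from stub 2, set `B(x) := u(x) − c x⁻¹ v(−1/(Nx))`, and bound `B` on `ℚ ∩ [1/(m+2), m+2]`
by the maximum of the continuous `Φ` on the COMPACT real interval `[1/(m+2), m+2] ⊂ (0,∞)`
(`IsCompact.exists_bound_of_continuousOn`).

Shape (for `ledger skeleton check` / `#h21_check_skeleton`): each stub is `theorem stub_<name> (binders) :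
<conclusion> := by sorry`; `_Goal.stub_<name> : Prop := type_of% @stub_<name>` names that statement (no text
duplicated, no `sorry` inherited — a type mentions no proof); the composition takes exactly these two
`Prop`s by name and concludes the route decl by name; the last `example` feeds the two stubs to it.

Disproof used: none relevant (no `Disproof.lean` / `Negative/` lemma exists for this crux at registration,
`ledger crux ls stmt-Langlands-3313`: no workfiles).

BC3 probes (planner folder `bc/*_probe*.lean`, quoted in NOTES.md): for each stub `S`,
`S → GaloisBoundaryBounded` and `S → Langlands` by `first | exact? | simpa | … | aesop` FAIL (stub 1 lacks the
cancellation, stub 2 lacks the regularised values; neither mentions reciprocity).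
-/

set_option linter.dupNamespace false

noncomputable section

namespace Summit.Langlands.Langlands.Cruxes.GaloisBoundaryBounded.Birth

open Summit.Langlands.Langlands.Theses.EvenArtinQuantumBoundary
open Literature.NumberTheory.GaloisRepresentations

/-! ## 1. The two stubs -/

/-- **STUB 1 — regularised values of the additive twists exist (Booker 2003, Lemma 1, at `s = 0`).**
For an irreducible even `σ : Γ_ℚ → GL₂(ℂ)`, a coefficient sequence `a` with `Σ a_n n^{-s} = L(s,σ)` on
`Re s > 1`, and every rational `α`, the additive twist `Σ_{n≥1} a_n e(nα) n^{-s}` agrees on `Re s > 1` with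
a function `D` meromorphic on `ℂ` and analytic at `s = 0` (so `D 0` is the regularised value `D_a(0;α)`).
Printed: "Let `α` be a rational number. Then `L(s, ρ, α)` has meromorphic continuation to the complex
plane, with poles possible only in the strip `0 < Re s < 1`" (the twist is a finite combination of
`L(s, σ ⊗ χ)`, `χ` Dirichlet characters, with entire Euler-factor corrections; Brauer + Hecke). KNOWN in
print; in the tree it is the `s = 0` case of the undischarged named fact
`Literature.NumberTheory.Automorphic.booker_additiveTwist_meromorphic` — given that fact this stub is
`exists_regularisedValue_of_booker_additiveTwist_meromorphic` with `u` read off as `D 0`; a sorry-free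
proof is the Brauer–Hecke continuation of all Dirichlet twists of `L(s,σ)` (size L).
[cite: Booker2003, Lemma 1 (p. 1092)] -/
theorem stub_regularisedValue
    (σ : FramedArtinRep ℚ 2) (a : ℕ → ℂ) (hirr : σ.toGaloisRep.IsIrreducible)
    (heven : ∀ (φ : ℚ →+* ℝ) (c : Field.absoluteGaloisGroup ℚ), IsComplexConjugation φ c →
      Matrix.GeneralLinearGroup.det (σ c) = 1)
    (ha : ∀ s : ℂ, 1 < s.re → LSeries a s = artinLFunction σ.toArtinRep s) (α : ℚ) :
    ∃ D : ℂ → ℂ, MeromorphicOn D Set.univ ∧ AnalyticAt ℂ D 0 ∧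
      ∀ s : ℂ, 1 < s.re →
        D s = LSeries (fun n : ℕ => a n * Complex.exp (2 * Real.pi * Complex.I * (n : ℂ) * ((α : ℚ) : ℂ))) s := by
  sorry

/-- **STUB 2 — quantum continuity of the Galois-born boundary function (OPEN; the bet).**
For an irreducible even `σ : Γ_ℚ → GL₂(ℂ)` of Artin conductor `N`, coefficient sequences `a` of `L(s,σ)`
and `b` of `L(s,σ^∨)`, and ANY regularised-value functions `u, v : ℚ → ℂ` of the additive twists of `a`
and `b` (for every rational `x`: `u x = D_a(0;x)`, `v x = D_b(0;x)` in the sense of stub 1 — by the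
identity theorem these values are unique, so "any" costs nothing), there is an admissible constant `c`,
`‖c‖ = N^{-1/2}` (expected: `c = η N^{-1/2}`, `η` the Fricke/root-number phase of `σ`), and a function
`Φ : ℝ → ℂ` CONTINUOUS on `(0, ∞)` with `Φ(x) = u(x) − c x⁻¹ v(−1/(Nx))` at every rational `x > 0`.
Why plausibly true: if `σ` is automorphic (`λ = 1/4` Maass newform of level `N`, Fricke pair `(f, g)`),
the weight-one Lewis–Fricke transform `ψ_N(z) = f(z) − c z⁻¹ g(−1/(Nz))` extends holomorphically to
`ℂ ∖ (−∞, 0]` (Lewis–Zagier period-function theory carried to the Fricke pair; Bruggeman–Lewis–Zagier)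
and its value at a rational `x > 0` is the regularised boundary value `u(x) − c x⁻¹ v(−1/(Nx))` (Mellin
shift past `s = 0`, all twists entire; Bruggeman's quantum Maass forms; Wilton-type bounds for the
horizontal drift of `−1/(Nz)`), so `Φ := ψ_N|_{(0,∞)}` is even real-analytic. Why it might fail: each
term has size `≍ q^{1+o(1)}` at `x = b/q` and nothing but automorphy is known to force cancellation, let
alone continuity; a certified computation for the conductor-1951 even icosahedral `σ` (Doud–Moore 2006)
could refute it (and then BB's boundedness is the fallback statement). Strictly stronger than part (ii)
of the crux (continuity on `(0,∞)` ⟹ boundedness on each compact `[1/(m+2), m+2]`, which is how the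
composition uses it). Size XL (open problem; numerically testable).
(Template in print: Zagier 2010, Example 1 — the eigenvalue-1/4 Maass form of Cohen's `σ(q)`: the
function `h(x)` is "the restriction of this function [holomorphic on `ℂ ∖ (−∞,0]`] to `ℝ₊` and hence is
real-analytic"; Booker 2003 p. 1097 pairs the twists at `α` and `−1/(Nα)`.)
[cite: Zagier2010QMF, Example 1, eqs. (13)–(14)] -/
theorem stub_quantumContinuity
    (σ : FramedArtinRep ℚ 2) (a b : ℕ → ℂ) (hirr : σ.toGaloisRep.IsIrreducible)
    (heven : ∀ (φ : ℚ →+* ℝ) (c : Field.absoluteGaloisGroup ℚ), IsComplexConjugation φ c →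
      Matrix.GeneralLinearGroup.det (σ c) = 1)
    (ha : ∀ s : ℂ, 1 < s.re → LSeries a s = artinLFunction σ.toArtinRep s)
    (hb : ∀ s : ℂ, 1 < s.re →
      LSeries b s = artinLFunction (FramedArtinRep.toArtinRep (FramedRep.dual σ)) s)
    (u v : ℚ → ℂ)
    (hu : ∀ x : ℚ, ∃ D : ℂ → ℂ, MeromorphicOn D Set.univ ∧ AnalyticAt ℂ D 0 ∧ D 0 = u x ∧
      ∀ s : ℂ, 1 < s.re →
        D s = LSeries (fun n : ℕ => a n * Complex.exp (2 * Real.pi * Complex.I * (n : ℂ) * ((x : ℚ) : ℂ))) s)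
    (hv : ∀ x : ℚ, ∃ D : ℂ → ℂ, MeromorphicOn D Set.univ ∧ AnalyticAt ℂ D 0 ∧ D 0 = v x ∧
      ∀ s : ℂ, 1 < s.re →
        D s = LSeries (fun n : ℕ => b n * Complex.exp (2 * Real.pi * Complex.I * (n : ℂ) * ((x : ℚ) : ℂ))) s) :
    ∃ c : ℂ, ‖c‖ = ((GaloisRep.artinConductorNat σ.toGaloisRep : ℕ) : ℝ) ^ (-(1 / 2 : ℝ)) ∧
      ∃ Φ : ℝ → ℂ, ContinuousOn Φ (Set.Ioi 0) ∧
        ∀ x : ℚ, 0 < x →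
          Φ ((x : ℚ) : ℝ) = u x - c * ((x : ℚ) : ℂ)⁻¹ *
            v ((-1 / ((GaloisRep.artinConductorNat σ.toGaloisRep : ℕ) * x)) : ℚ) := by
  sorry

/-! ## 2. The stub statements as named propositions (the composition's hypotheses, by name)

`_Goal` is an internal name on purpose (audits listing declarations by short name find the `stub_*` THEOREMS);
each `_Goal.stub_x` is `type_of% @stub_x` — literally the stub's type, so no text is duplicated and no `sorry`
is inherited. -/

namespace _Goal

/-- The statement of `stub_regularisedValue`, as a named `Prop` (literally its type). [folklore] -/
def stub_regularisedValue : Prop :=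
  type_of% @Summit.Langlands.Langlands.Cruxes.GaloisBoundaryBounded.Birth.stub_regularisedValue

/-- The statement of `stub_quantumContinuity`, as a named `Prop` (literally its type). [folklore] -/
def stub_quantumContinuity : Prop :=
  type_of% @Summit.Langlands.Langlands.Cruxes.GaloisBoundaryBounded.Birth.stub_quantumContinuity

end _Goal

/-! ## 3. The composition (kernel-checked, no `sorry`): REGULARISE (σ and σ^∨) → CONTINUITY → COMPACTNESS → BB by name -/

/-- The contragredient of an even framed Galois representation is even:
`det σ^∨(c) = (det σ(c))⁻¹ = 1` at every complex conjugation `c`. [folklore] -/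
theorem det_dual_eq_one_of_even (σ : FramedArtinRep ℚ 2)
    (heven : ∀ (φ : ℚ →+* ℝ) (c : Field.absoluteGaloisGroup ℚ), IsComplexConjugation φ c →
      Matrix.GeneralLinearGroup.det (σ c) = 1)
    (φ : ℚ →+* ℝ) (c : Field.absoluteGaloisGroup ℚ) (hc : IsComplexConjugation φ c) :
    Matrix.GeneralLinearGroup.det (FramedRep.dual σ c) = 1 := by
  change Matrix.GeneralLinearGroup.det (glTransposeInv (Fin 2) ℂ (σ c)) = 1
  rw [det_glTransposeInv, heven φ c hc, inv_one]

/-- **BB from the two stubs.** Regularised-value functions `u` (for `σ`, `a`) and `v` (for the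
contragredient `σ^∨ = FramedRep.dual σ`, `b`; the dual is irreducible by
`FramedRep.isIrreducible_toContinuousRep_dual` and even by `det_dual_eq_one_of_even`) come from
`stub_regularisedValue`; `stub_quantumContinuity` supplies an admissible `c` and a continuous `Φ` on
`(0,∞)` interpolating `B(x) := u(x) − c x⁻¹ v(−1/(Nx))` at the positive rationals; `B` is then bounded on
`ℚ ∩ [1/(m+2), m+2]` by the bound of `Φ` on the compact real interval `[1/(m+2), m+2] ⊂ (0,∞)`. The
hypotheses are, by name, the statements of the two stubs; the conclusion is the route decl. [folklore] -/
theorem GaloisBoundaryBounded_of (h₁ : _Goal.stub_regularisedValue) (h₂ : _Goal.stub_quantumContinuity) :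
    GaloisBoundaryBounded := by
  intro σ a b hirr heven ha hb
  -- regularised values for `a` (σ) at every rational
  choose Da hDa using h₁ σ a hirr heven ha
  -- regularised values for `b` (σ^∨): the dual is again irreducible and even
  have hirr' : (FramedGaloisRep.toGaloisRep (FramedRep.dual σ)).IsIrreducible :=
    FramedRep.isIrreducible_toContinuousRep_dual σ hirr
  have heven' : ∀ (φ : ℚ →+* ℝ) (c : Field.absoluteGaloisGroup ℚ), IsComplexConjugation φ c →
      Matrix.GeneralLinearGroup.det (FramedRep.dual σ c) = 1 :=
    det_dual_eq_one_of_even σ heven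
  choose Db hDb using h₁ (FramedRep.dual σ) b hirr' heven' hb
  -- the regularised-value functions
  let u : ℚ → ℂ := fun x => Da x 0
  let v : ℚ → ℂ := fun x => Db x 0
  have hu : ∀ x : ℚ, ∃ D : ℂ → ℂ, MeromorphicOn D Set.univ ∧ AnalyticAt ℂ D 0 ∧ D 0 = u x ∧
      ∀ s : ℂ, 1 < s.re →
        D s = LSeries (fun n : ℕ => a n * Complex.exp (2 * Real.pi * Complex.I * (n : ℂ) * ((x : ℚ) : ℂ))) s :=
    fun x => ⟨Da x, (hDa x).1, (hDa x).2.1, rfl, (hDa x).2.2⟩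
  have hv : ∀ x : ℚ, ∃ D : ℂ → ℂ, MeromorphicOn D Set.univ ∧ AnalyticAt ℂ D 0 ∧ D 0 = v x ∧
      ∀ s : ℂ, 1 < s.re →
        D s = LSeries (fun n : ℕ => b n * Complex.exp (2 * Real.pi * Complex.I * (n : ℂ) * ((x : ℚ) : ℂ))) s :=
    fun x => ⟨Db x, (hDb x).1, (hDb x).2.1, rfl, (hDb x).2.2⟩
  -- quantum continuity: an admissible `c` and a continuous interpolant `Φ` on `(0, ∞)`
  obtain ⟨c, hc, Φ, hΦ, hΦeq⟩ := h₂ σ a b hirr heven ha hb u v hu hv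
  refine ⟨c, fun x => u x - c * ((x : ℚ) : ℂ)⁻¹ *
      v ((-1 / ((GaloisRep.artinConductorNat σ.toGaloisRep : ℕ) * x)) : ℚ), hc, ?_, ?_⟩
  · -- (i) + the shape of `B`: the witnesses are the chosen continuations
    intro x _hx
    exact ⟨u x, v ((-1 / ((GaloisRep.artinConductorNat σ.toGaloisRep : ℕ) * x)) : ℚ), hu x, hv _, rfl⟩
  · -- (ii) boundedness on `ℚ ∩ [1/(m+2), m+2]` from continuity on the compact real interval
    intro m
    have hlo : (0 : ℝ) < 1 / ((m : ℝ) + 2) := by positivity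
    have hK : Set.Icc (1 / ((m : ℝ) + 2)) ((m : ℝ) + 2) ⊆ Set.Ioi 0 :=
      fun y hy => lt_of_lt_of_le hlo hy.1
    obtain ⟨M, hM⟩ := (isCompact_Icc (a := 1 / ((m : ℝ) + 2)) (b := (m : ℝ) + 2)).exists_bound_of_continuousOn
      (hΦ.mono hK)
    refine ⟨M, fun x hx₁ hx₂ => ?_⟩
    have hx0 : (0 : ℚ) < x := lt_of_lt_of_le (by positivity) hx₁
    have hmem : ((x : ℚ) : ℝ) ∈ Set.Icc (1 / ((m : ℝ) + 2)) ((m : ℝ) + 2) := by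
      constructor
      · have h := (Rat.cast_le (K := ℝ)).mpr hx₁
        push_cast at h
        exact h
      · have h := (Rat.cast_le (K := ℝ)).mpr hx₂
        push_cast at h
        exact h
    have hB := hM ((x : ℚ) : ℝ) hmem
    rw [hΦeq x hx0] at hB
    exact hB

/-- By-name sanity check (an `example`, so it is not a declaration of the file): the two stubs feed the
composition as they stand. -/
example : GaloisBoundaryBounded :=
  GaloisBoundaryBounded_of stub_regularisedValue stub_quantumContinuity

end Summit.Langlands.Langlands.Cruxes.GaloisBoundaryBounded.Birth

end
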